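import Summits.BirchSwinnertonDyer.BirchSwinnertonDyer.Theses.KatoDescentPotSupersingular
import Summits.BirchSwinnertonDyer.BirchSwinnertonDyer.Theorems.KatoDescentPotSupersingularWildLowerSubgroupWitness
import HarnessLib

/-!
# Route `KatoDescentPotSupersingular` (rung K9, cell `bsd-potss`): the registered BC5 rung
# `Sig.stub_lower_mod3_rung` of the crux `WildLowerHalfRankZero` (item stmt-BirchSwinnertonDyer-19195) IS the
# crux truncated at `1`, and with Cassels–Tate it already gives the crux on every shallow row
# (a `--supports … --as helper` file; seat bsd-potss-k9-c2, generation 3)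

The BC3 skeleton of the crux (v2/v3, registered) keeps a plan-only BC5 rung `Sig.stub_lower_mod3_rung`: on a
wild rank-`0` row with `3 ∣ #Ш_an` (`1 ≤ ord₃ q`), `1 ≤ ord₃ #Ш`. Generation 2 proved it VERBATIM from a
`3`-torsion witness per row (`lower_mod3_rung_of_witnesses`, p421575). This file places it against the crux
with no witness at all:

* `missingLowerBoundAt_shallow_of_mod3Rung`: the rung (stated verbatim as a hypothesis) + the Cassels–Tate
  rounding of the generation-3 certificate road (`le_padicValNat_shaOrder_of_pow_dvd_of_casselsTate`, `k = 1`: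
  `3 ∣ #Ш ⇒ 2 ≤ ord₃ #Ш`) give `MissingLowerBoundAt W 3` on EVERY wild rank-`0` row whose `#Ш_an` has
  `ord₃ ≤ 2` — the unit rows and 1 759 of the 1 770 intrinsic census classes at their minimal member;
* `mod3Rung_of_wildLowerHalfRankZero`: conversely the crux gives the rung (the rational `#Ш_an` is unique),
  so the rung is EXACTLY the crux truncated at `1`;
* `wildLowerHalfRankZero_of_mod3Rung_of_deepRows`: the crux BY NAME from the rung, Cassels–Tate, GZK and the
  DEEP rows (`ord₃ #Ш_an ≥ 3`; census: 11 classes) displayed.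

HONEST LABEL: the rung is open class-wide exactly like the crux (in rank `0`, `Ш[3] ≠ 0 ⟸ 3 ∣ #Ш_an` is the
first case of Kato's Conj. 12.10 at `3` on these rows; no mechanism in print — presearch 2026-08-26: the
"(rib2)" implication `L^alg ≡ 0 mod p ⇒ Sel_p ≠ 0` is itself only DEDUCED from main conjectures, even at good
ordinary `p > 3` [arXiv:2402.07317 §1.1.2]); every theorem here is conditional bookkeeping and the item is NOT
closed. BSD is not proved by any of this. Seat `bsd-potss-k9-c2` (prover-bsd-potss-k9-c2-g3-0), generation 3.

References: [SilvermanAEC2009] Thm. X.4.14; [Miller2011LMS] Def. 1.1; [Kato2004Asterisque] Conj. 12.10 (p. 224).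
-/

set_option autoImplicit false
-- sibling precedent (`KatoDescentPotSupersingularAssembly.lean`): the directory name repeats the summit name
set_option linter.dupNamespace false

noncomputable section

open scoped Classical

namespace Summit.BirchSwinnertonDyer.BirchSwinnertonDyer.Theorems

open WeierstrassCurve Literature.NumberTheory.EllipticCurves
  Literature.NumberTheory.EllipticCurves.Rank1Residual
  Literature.NumberTheory.EllipticCurves.Rank1Residual.Typed
  Summit.BirchSwinnertonDyer.Rank1Residual.Additive
  Summit.BirchSwinnertonDyer.Rank1Residual
  Summit.BirchSwinnertonDyer.BirchSwinnertonDyer.Theses.KatoDescentPotSupersingular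

/-! ## The rung, the shallow rows, and the crux -/

/-- **The registered BC5 rung + Cassels–Tate ⇒ L₀ on every SHALLOW wild rank-`0` row.** The plan-only rung
`Sig.stub_lower_mod3_rung` of the registered skeleton (v2/v3: on a wild rank-`0` row with `1 ≤ ord₃ #Ш_an`,
`1 ≤ ord₃ #Ш`), stated VERBATIM as the hypothesis `hrung`, gives `3 ∣ #Ш` on the content rows, and the
Cassels–Tate rounding of §1 (`k = 1`) turns it into `2 ≤ ord₃ #Ш`; so on every row with `ord₃ #Ш_an ≤ 2` —
1 759 of the 1 770 intrinsic census classes at their minimal member, and every unit row — the rung IS the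
crux. Conditional on `hCT`, `hGZK` and the rung (itself open class-wide: the crux truncated at `1`).
[cite: SilvermanAEC2009, Thm. X.4.14] [cite: Miller2011LMS, Def. 1.1] [cite: Kato2004Asterisque, Conj. 12.10 (p. 224)] -/
theorem missingLowerBoundAt_shallow_of_mod3Rung (hCT : exists_casselsTate_pairing (K := ℚ))
    (hGZK : rank_eq_analyticRank_of_analyticRank_le_one)
    (hrung : ∀ (W : WeierstrassCurve ℚ) [W.IsElliptic] [W.IsGloballyMinimal] [Fact (3 : ℕ).Prime],
      W.analyticRank = 0 → ClassO6 W 3 →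
      (∃ q : ℚ, shaAn W = (q : ℂ) ∧ 1 ≤ padicValRat 3 q) → 1 ≤ padicValNat 3 W.shaOrder)
    (W : WeierstrassCurve ℚ) [W.IsElliptic] [W.IsGloballyMinimal] [Fact (3 : ℕ).Prime]
    (hr : W.analyticRank = 0) (hO : ClassO6 W 3) {q : ℚ} (hq : shaAn W = (q : ℂ))
    (hv : padicValRat 3 q ≤ 2) : MissingLowerBoundAt W 3 := by
  have hr1 : W.analyticRank ≤ 1 := by rw [hr]; exact zero_le_one
  by_cases h1 : 1 ≤ padicValRat 3 q
  · haveI : Finite W.sha := (hGZK W hr1).2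
    have hne : W.shaOrder ≠ 0 := by
      rw [WeierstrassCurve.shaOrder]; exact (Nat.card_pos (α := W.sha)).ne'
    have h3 : 3 ^ 1 ∣ W.shaOrder := (padicValNat_dvd_iff_le hne).mpr (hrung W hr hO ⟨q, hq, h1⟩)
    exact missingLowerBoundAt_of_pow_dvd_of_casselsTate W 3 hCT hGZK hr1 hq (k := 1) (by simpa using hv) h3
  · exact ⟨q, hq, by omega⟩

/-- **Conversely the crux gives the rung** (the rational `q` with `shaAn W = q` is unique): so
`Sig.stub_lower_mod3_rung` is EXACTLY the crux truncated at `1`, and by the previous theorem the truncation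
loses nothing on the shallow rows. Bookkeeping. [cite: Miller2011LMS, Def. 1.1] -/
theorem mod3Rung_of_wildLowerHalfRankZero
    (hL : Summit.BirchSwinnertonDyer.BirchSwinnertonDyer.Theses.KatoDescentPotSupersingular.WildLowerHalfRankZero) :
    ∀ (W : WeierstrassCurve ℚ) [W.IsElliptic] [W.IsGloballyMinimal] [Fact (3 : ℕ).Prime],
      W.analyticRank = 0 → ClassO6 W 3 →
      (∃ q : ℚ, shaAn W = (q : ℂ) ∧ 1 ≤ padicValRat 3 q) → 1 ≤ padicValNat 3 W.shaOrder := by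
  intro W _ _ _ hr hO hq1
  obtain ⟨q, hq, h1⟩ := hq1
  obtain ⟨q', hq', hle⟩ := hL W hr hO
  have hqq : q' = q := by exact_mod_cast hq'.symm.trans hq
  subst hqq
  exact_mod_cast h1.trans hle

/-- **The crux from the rung on the shallow rows and a certificate on the deep rows.** `WildLowerHalfRankZero`
BY NAME ⟸ Cassels–Tate + GZK + the registered rung `Sig.stub_lower_mod3_rung` (verbatim, `hrung`) + on every
wild rank-`0` row with no rational `#Ш_an` of `ord₃ ≤ 2` (i.e. `ord₃ #Ш_an ≥ 3`) the lower half (`hdeep`, displayed: census 11 classes, all members deep;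
no Cassels transport needed here because the rung is asked row by row). The BC5 rung is thus the whole crux up
to the deep rows. Conditional; nothing credited. [cite: SilvermanAEC2009, Thm. X.4.14] [cite: Miller2011LMS, Def. 1.1]
[cite: Kato2004Asterisque, Conj. 12.10 (p. 224)] -/
theorem wildLowerHalfRankZero_of_mod3Rung_of_deepRows (hCT : exists_casselsTate_pairing (K := ℚ))
    (hGZK : rank_eq_analyticRank_of_analyticRank_le_one)
    (hrung : ∀ (W : WeierstrassCurve ℚ) [W.IsElliptic] [W.IsGloballyMinimal] [Fact (3 : ℕ).Prime],
      W.analyticRank = 0 → ClassO6 W 3 →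
      (∃ q : ℚ, shaAn W = (q : ℂ) ∧ 1 ≤ padicValRat 3 q) → 1 ≤ padicValNat 3 W.shaOrder)
    (hdeep : ∀ (W : WeierstrassCurve ℚ) [W.IsElliptic] [W.IsGloballyMinimal] [Fact (3 : ℕ).Prime],
      W.analyticRank = 0 → ClassO6 W 3 → (∀ q : ℚ, shaAn W = (q : ℂ) → 2 < padicValRat 3 q) →
        MissingLowerBoundAt W 3) :
    Summit.BirchSwinnertonDyer.BirchSwinnertonDyer.Theses.KatoDescentPotSupersingular.WildLowerHalfRankZero := by
  intro W _ _ _ hr hO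
  -- shallow rows (a rational `#Ш_an` with `ord₃ ≤ 2`) by the rung + Cassels–Tate; every other row is `hdeep`'s
  by_cases hsh : ∃ q : ℚ, shaAn W = (q : ℂ) ∧ padicValRat 3 q ≤ 2
  · obtain ⟨q, hq, hv⟩ := hsh
    exact missingLowerBoundAt_shallow_of_mod3Rung hCT hGZK hrung W hr hO hq hv
  · exact hdeep W hr hO fun q hq ↦ lt_of_not_ge fun hv ↦ hsh ⟨q, hq, hv⟩

end Summit.BirchSwinnertonDyer.BirchSwinnertonDyer.Theorems

end
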